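import Literature.ModelTheory.ExponentialFields.DefinablyCompleteLocalInverse
import HarnessLib

/-!
# The inverse function theorem over a definably complete ordered field, III: the local inverse

Topic `Literature/ModelTheory/ExponentialFields`.  Continuation of
`DefinablyCompleteInverseFunction.lean` / `DefinablyCompleteLocalInverse.lean`
(Fornasiero–Servi 2010, §1.2; van den Dries 1998, Ch. 7, §2).  For a definable map
`F : Kⁿ → Kⁿ` continuous on the closed box `B` of radius `r` around `a`, with Jacobian within
`η` of the identity on `B` (`2 n η ≤ 1`), part I gives injectivity on `B` and surjectivity of
the open box onto the `ℓ¹`-ball of radius `r / 4` around `F a`.  Here: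

* `exists_two_sided_inverse_of_near_one` — a matrix within `η` of the identity is invertible
  (diagonal dominance and Mathlib's `Matrix.vecMul_injective_iff_isUnit`);
* **`IsDefinablyComplete.exists_localInverse_of_jacobian_near_one`** — a *definable local
  inverse*: a definable `G : Kⁿ → Kⁿ` with `F (G y) = y`, `|G y - a|_∞ < r` on the sup-ball
  `W = {y | ∀ i, |yᵢ - F a i| < r / (4 n)}`, with `G (F x) = x` for `x` in the open box with
  `F x ∈ W`, and the Lipschitz bound `|G y - G y'|_∞ ≤ 2 |y - y'|_∞` on `W`;
* **`HasLinDerivAt.localInverse`** — *differentiability of inverse selections*: if `G` selects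
  preimages in the open box on a neighbourhood of `y₀` (sup-ball form), satisfies the Lipschitz
  bound there, and the components of `F` are differentiable at `x₀ = G y₀` with Jacobian `M`
  having the left inverse `Q`, then the `i`-th component of `G` is differentiable at `y₀`
  with gradient the `i`-th row of `Q` (norm-free `ε`–`δ` computation).

Everything is proved; no definitions, no named facts.  Conventions as in parts I–II.

## References

* A. Fornasiero, T. Servi, *Definably complete Baire structures*, Fund. Math. 209 (2010),
  §1.2. [FornasieroServi2010]
* L. van den Dries, *Tame topology and o-minimal structures* (1998), Ch. 7, §2.
  [Dries1998]
-/

open Set Function FirstOrder FirstOrder.Language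
open _root_.Filter _root_.Topology

namespace Literature.ModelTheory.ExponentialFields

universe u v

variable {K : Type*} [Field K] [LinearOrder K] [IsStrictOrderedRing K] [TopologicalSpace K]
  [OrderTopology K] {L : FirstOrder.Language.{u, v}} [L.Structure K] {n : ℕ}

/-! ### Near-identity matrices are invertible -/

omit [TopologicalSpace K] [OrderTopology K] [L.Structure K] in
/-- **A matrix within `η` of the identity, `2 n η ≤ 1`, has a two-sided inverse** (its left
kernel is trivial by diagonal dominance, so it is a unit by
`Matrix.vecMul_injective_iff_isUnit`). [folklore] -/
theorem exists_two_sided_inverse_of_near_one {A : Fin n → Fin n → K} {η : K}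
    (hη : 2 * n * η ≤ 1) (hA : ∀ i j, |A i j - if i = j then 1 else 0| ≤ η) :
    ∃ Q : Fin n → Fin n → K, (∀ i j, ∑ k, Q i k * A k j = if i = j then 1 else 0) ∧
      (∀ i j, ∑ k, A i k * Q k j = if i = j then 1 else 0) := by
  classical
  set M : Matrix (Fin n) (Fin n) K := Matrix.of A with hM
  have hinj : Function.Injective M.vecMul := by
    intro v w hvw
    have h : ∀ j, ∑ i, (v - w) i * A i j = 0 := by
      intro j
      have h1 := congr_fun hvw j
      simp only [Matrix.vecMul, dotProduct, hM, Matrix.of_apply] at h1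
      simp only [Pi.sub_apply, sub_mul, Finset.sum_sub_distrib, h1, sub_self]
    have h0 := eq_zero_of_forall_sum_mul_eq_zero hη hA h
    exact sub_eq_zero.1 h0
  have hunit : IsUnit M := Matrix.vecMul_injective_iff_isUnit.1 hinj
  have hdet : IsUnit M.det := (Matrix.isUnit_iff_isUnit_det M).1 hunit
  have h1 : M⁻¹ * M = 1 := Matrix.nonsing_inv_mul M hdet
  have h2 : M * M⁻¹ = 1 := Matrix.mul_nonsing_inv M hdet
  refine ⟨fun i j => M⁻¹ i j, fun i j => ?_, fun i j => ?_⟩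
  · have h := congr_fun (congr_fun h1 i) j
    rw [Matrix.mul_apply, Matrix.one_apply] at h
    simpa [hM] using h
  · have h := congr_fun (congr_fun h2 i) j
    rw [Matrix.mul_apply, Matrix.one_apply] at h
    simpa [hM] using h

/-! ### A definable local inverse -/

omit [TopologicalSpace K] [OrderTopology K] in
/-- Sup-balls `{y | ∀ i, |yᵢ - cᵢ| < ρ}` are definable (with `<` definable). [folklore] -/
theorem definable_supBall
    (hlt : (univ : Set K).Definable L {v : Fin 2 → K | v 0 < v 1})
    {ι : Type*} [Finite ι] (c : ι → K) (ρ : K) :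
    (univ : Set K).Definable L {y : ι → K | ∀ i, |y i - c i| < ρ} := by
  have h := definable_iInter_of_finite (L := L) (A := (univ : Set K)) fun i : ι =>
    (definable_setOf_lt_params hlt (definableFun_const_params _ (mem_univ (c i - ρ)))
      (definableFun_proj_params (α := ι) i)).inter
    (definable_setOf_lt_params hlt (definableFun_proj_params (α := ι) i)
      (definableFun_const_params _ (mem_univ (c i + ρ))))
  refine (congrArg _ ?_).mpr h
  ext y
  simp only [mem_setOf_eq, mem_iInter, mem_inter_iff]
  refine forall_congr' fun i => ?_
  rw [abs_sub_lt_iff]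
  constructor <;> rintro ⟨h1, h2⟩ <;> constructor <;> linarith

/-- **A definable local inverse** (Jacobian near the identity): under the hypotheses of the
open mapping theorem `exists_eq_of_jacobian_near_one` (the definable `F` continuous on the
closed box `B` of radius `r` around `a`, partial derivatives within `η` of the identity on `B`,
`2 n η ≤ 1`) there is a definable `G : Kⁿ → Kⁿ` (given componentwise) which on the sup-ball
`W = {y | ∀ i, |yᵢ - F a i| < r/(4n)}` selects the preimage in the open box — `|G y - a|_∞ < r`
and `F (G y) = y` —, inverts `F` there — `G (F x) = x` when `|x - a|_∞ < r` and `F x ∈ W` —,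
and is Lipschitz: `|G y j - G y' j| ≤ 2 μ` whenever `|yₖ - y'ₖ| ≤ μ` for all `k`
(`y, y' ∈ W`). [folklore] -/
theorem _root_.FirstOrder.Language.IsDefinablyComplete.exists_localInverse_of_jacobian_near_one
    (hDC : L.IsDefinablyComplete K)
    (hlt : (univ : Set K).Definable L {v : Fin 2 → K | v 0 < v 1})
    (hadd : (univ : Set K).Definable L {v : Fin 3 → K | v 2 = v 0 + v 1})
    (hmul : (univ : Set K).Definable L {v : Fin 3 → K | v 2 = v 0 * v 1})
    {F : (Fin n → K) → Fin n → K} (hF : ∀ i, (univ : Set K).DefinableFun L fun x => F x i)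
    {J : (Fin n → K) → Fin n → Fin n → K} {η : K} (hη : 2 * n * η ≤ 1)
    {a : Fin n → K} {r : K} (hr : 0 < r)
    (hcont : ∀ i, ContinuousOn (fun x => F x i) {x | ∀ j, a j - r ≤ x j ∧ x j ≤ a j + r})
    (hder : ∀ x : Fin n → K, (∀ j, a j - r ≤ x j ∧ x j ≤ a j + r) →
      ∀ i j, HasPartialDerivAt (fun z => F z i) j (J x i j) x)
    (hJ : ∀ x : Fin n → K, (∀ j, a j - r ≤ x j ∧ x j ≤ a j + r) →
      ∀ i j, |J x i j - if i = j then 1 else 0| ≤ η) :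
    ∃ G : (Fin n → K) → Fin n → K, (∀ i, (univ : Set K).DefinableFun L fun y => G y i) ∧
      (∀ y : Fin n → K, (∀ i, |y i - F a i| < r / (4 * n)) →
        (∀ j, |G y j - a j| < r) ∧ F (G y) = y) ∧
      (∀ x : Fin n → K, (∀ j, |x j - a j| < r) → (∀ i, |F x i - F a i| < r / (4 * n)) →
        G (F x) = x) ∧
      (∀ y y' : Fin n → K, (∀ i, |y i - F a i| < r / (4 * n)) →
        (∀ i, |y' i - F a i| < r / (4 * n)) → ∀ μ : K, (∀ k, |y k - y' k| ≤ μ) →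
          ∀ j, |G y j - G y' j| ≤ 2 * μ) := by
  classical
  rcases isEmpty_or_nonempty (Fin n) with hn | hn
  · refine ⟨fun _ => a, fun i => (hn.false i).elim, fun y _ => ⟨fun j => (hn.false j).elim,
      funext fun i => (hn.false i).elim⟩, fun x _ _ => funext fun j => (hn.false j).elim,
      fun y y' _ _ μ _ j => (hn.false j).elim⟩
  have hn0 : (0 : K) < n := by
    have : 0 < n := Fin.pos_iff_nonempty.2 hn
    exact_mod_cast this
  -- the sup-ball `W` lies in the `ℓ¹`-ball of radius `r / 4`
  set W : Set (Fin n → K) := {y | ∀ i, |y i - F a i| < r / (4 * n)} with hW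
  have hWsum : ∀ y ∈ W, ∑ i, |y i - F a i| < r / 4 := by
    intro y hy
    calc ∑ i, |y i - F a i| < ∑ _i : Fin n, r / (4 * n) :=
          Finset.sum_lt_sum_of_nonempty Finset.univ_nonempty fun i _ => hy i
      _ = r / 4 := by
          have hn' : (n : K) ≠ 0 := hn0.ne'
          rw [Finset.sum_const, Finset.card_univ, Fintype.card_fin, nsmul_eq_mul]
          field_simp
  -- the open box lies in the closed box `B`
  set B : Set (Fin n → K) := {x | ∀ j, a j - r ≤ x j ∧ x j ≤ a j + r} with hB
  have hopenB : ∀ x : Fin n → K, (∀ j, |x j - a j| < r) → x ∈ B := fun x hx j =>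
    ⟨by linarith [(abs_lt.1 (hx j)).1], by linarith [(abs_lt.1 (hx j)).2]⟩
  have hBbox : ∀ x ∈ B, ∀ y ∈ B, ∀ w : Fin n → K,
      (∀ j, min (x j) (y j) ≤ w j ∧ w j ≤ max (x j) (y j)) → w ∈ B := by
    intro x hx y hy w hw j
    exact ⟨le_trans (le_min (hx j).1 (hy j).1) (hw j).1, le_trans (hw j).2 (max_le (hx j).2 (hy j).2)⟩
  have hinj : InjOn F B := hDC.injOn_of_jacobian_near_one hlt hadd hmul hF hη hBbox hder hJ
  -- existence of preimages over `W`
  have hex : ∀ y ∈ W, ∃ x : Fin n → K, (∀ j, |x j - a j| < r) ∧ F x = y := fun y hy =>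
    hDC.exists_eq_of_jacobian_near_one hlt hadd hmul hF hη hr hcont hder hJ (hWsum y hy)
  set G : (Fin n → K) → Fin n → K := fun y => if hy : y ∈ W then (hex y hy).choose else a
    with hG
  have hGW : ∀ y ∈ W, (∀ j, |G y j - a j| < r) ∧ F (G y) = y := by
    intro y hy
    have h := (hex y hy).choose_spec
    simp only [hG, dif_pos hy]
    exact h
  have hGW' : ∀ y, y ∉ W → G y = a := fun y hy => by simp only [hG, dif_neg hy]
  -- uniqueness of the preimage in the open box
  have huniq : ∀ y ∈ W, ∀ x : Fin n → K, (∀ j, |x j - a j| < r) → F x = y → x = G y := by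
    intro y hy x hx hFx
    have h := hGW y hy
    exact hinj (hopenB x hx) (hopenB _ h.1) (hFx.trans h.2.symm)
  refine ⟨G, ?_, fun y hy => hGW y hy, ?_, ?_⟩
  · -- definability of the components of `G`
    intro i
    have hWdef : (univ : Set K).Definable L W := definable_supBall hlt (fun i => F a i) _
    -- variables `w : Option (Fin n) ⊕ Fin n → K`: `y = w ∘ inl ∘ some`, `t = w (inl none)`,
    -- `x = w ∘ inr`
    have hWv : (univ : Set K).Definable L
        {w : Option (Fin n) ⊕ Fin n → K | (fun k => w (Sum.inl (some k))) ∈ W} :=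
      hWdef.preimage_comp fun k => Sum.inl (some k)
    have hbox : (univ : Set K).Definable L
        {w : Option (Fin n) ⊕ Fin n → K | ∀ j, |w (Sum.inr j) - a j| < r} := by
      have h := (definable_supBall hlt a r (L := L)).preimage_comp
        (fun j => (Sum.inr j : Option (Fin n) ⊕ Fin n))
      exact h
    have hFeq : (univ : Set K).Definable L
        {w : Option (Fin n) ⊕ Fin n → K | ∀ k, F (fun j => w (Sum.inr j)) k = w (Sum.inl (some k))} := by
      have h := definable_iInter_of_finite (L := L) (A := (univ : Set K)) fun k : Fin n =>
        definable_setOf_eq_params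
          ((hF k).comp fun j => definableFun_proj_params (L := L) (A := (univ : Set K))
            (Sum.inr j : Option (Fin n) ⊕ Fin n))
          (definableFun_proj_params (Sum.inl (some k)))
      refine (congrArg _ ?_).mpr h
      ext w
      simp only [mem_setOf_eq, mem_iInter]
    have hti : (univ : Set K).Definable L
        {w : Option (Fin n) ⊕ Fin n → K | w (Sum.inl none) = w (Sum.inr i)} :=
      definable_setOf_eq_params (definableFun_proj_params _) (definableFun_proj_params _)
    have hbody := (hbox.inter hFeq).inter hti
    have hE := hbody.exists_of_finite (α := Option (Fin n)) (β := Fin n)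
    -- `hE : Definable {v | ∃ x, (∀ j, |x j - a j| < r) ∧ (∀ k, F x k = v (some k)) ∧ v none = x i}`
    have hWo : (univ : Set K).Definable L {v : Option (Fin n) → K | v ∘ some ∈ W} :=
      hWdef.preimage_comp some
    have hcst : (univ : Set K).Definable L {v : Option (Fin n) → K | v none = a i} :=
      definable_setOf_eq_params (definableFun_proj_params none)
        (definableFun_const_params _ (mem_univ (a i)))
    have hS := (hWo.inter hE).union (hWo.compl.inter hcst)
    unfold Set.DefinableFun
    refine (congrArg _ ?_).mpr hS
    ext v
    simp only [Function.tupleGraph, mem_setOf_eq, mem_union, mem_inter_iff, mem_compl_iff,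
      Sum.elim_inl, Sum.elim_inr]
    by_cases hv : v ∘ some ∈ W
    · constructor
      · intro h
        refine Or.inl ⟨hv, G (v ∘ some), ⟨⟨(hGW _ hv).1, fun k => ?_⟩, h.symm⟩⟩
        exact congr_fun (hGW _ hv).2 k
      · rintro (⟨-, x, ⟨hxr, hFx⟩, hvi⟩ | ⟨hv', -⟩)
        · have hx : x = G (v ∘ some) := huniq _ hv x hxr (funext hFx)
          rw [hvi, hx]
        · exact absurd hv hv'
    · constructor
      · intro h
        exact Or.inr ⟨hv, by rw [← h, hGW' _ hv]⟩
      · rintro (⟨hv', -⟩ | ⟨-, h⟩)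
        · exact absurd hv' hv
        · rw [h, hGW' _ hv]
  · -- `G ∘ F = id` on the open box, where `F x ∈ W`
    intro x hx hFx
    exact (huniq (F x) hFx x hx rfl).symm
  · -- the Lipschitz bound (expansion bound between the two preimages)
    intro y y' hy hy' μ hμ j
    have hGy := hGW y hy
    have hGy' := hGW y' hy'
    have hsub : ∀ w : Fin n → K,
        (∀ j, min (G y' j) (G y j) ≤ w j ∧ w j ≤ max (G y' j) (G y j)) → w ∈ B :=
      fun w hw => hBbox _ (hopenB _ hGy'.1) _ (hopenB _ hGy.1) w hw
    have h := hDC.abs_sub_le_two_mul_of_jacobian_near_one hlt hadd hmul hF hη (x := G y')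
      (y := G y) (fun w hw i j => hder w (hsub w hw) i j) (fun w hw i j => hJ w (hsub w hw) i j)
      (μ := μ) (fun k => by rw [hGy.2, hGy'.2]; exact hμ k)
    exact h j

/-! ### Differentiability of the local inverse -/

omit [TopologicalSpace K] [OrderTopology K] [L.Structure K] in
/-- **Inverse selections are differentiable**: let `G : Kⁿ → Kⁿ` satisfy, on the sup-ball of
radius `ρ > 0` around `y₀`, `F (G y) = y` and the Lipschitz bound
`|G y j - G y₀ j| ≤ 2 μ` whenever `|yₖ - y₀ₖ| ≤ μ` for all `k`; let the components of `F` be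
differentiable at `x₀ = G y₀` with Jacobian `M` (`HasLinDerivAt (F · l) (M l) x₀`), and let
`Q` be a left inverse of `M` (`Q M = 1`).  Then the `i`-th component of `G` is differentiable at `y₀`
with gradient the `i`-th row of `Q`.  (With `k = G y - x₀` and `e = (y - y₀) - M k` one has
`k = Q (y - y₀) - Q e`, `|k|_∞ ≤ 2 |y - y₀|_∞` and `|e| ≤ ε₁ Σ |kⱼ|`.) [folklore] -/
theorem HasLinDerivAt.localInverse {F G : (Fin n → K) → Fin n → K}
    {M Q : Fin n → Fin n → K} {y₀ : Fin n → K} {ρ : K} (hρ : 0 < ρ)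
    (hFG : ∀ y : Fin n → K, (∀ k, |y k - y₀ k| < ρ) → F (G y) = y)
    (hLip : ∀ y : Fin n → K, (∀ k, |y k - y₀ k| < ρ) → ∀ μ : K, (∀ k, |y k - y₀ k| ≤ μ) →
      ∀ j, |G y j - G y₀ j| ≤ 2 * μ)
    (hF : ∀ l, HasLinDerivAt (fun x => F x l) (M l) (G y₀))
    (hQM : ∀ i j, ∑ k, Q i k * M k j = if i = j then 1 else 0) (i : Fin n) :
    HasLinDerivAt (fun y => G y i) (Q i) y₀ := by
  classical
  intro ε hε
  rcases isEmpty_or_nonempty (Fin n) with hn | hn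
  · exact (hn.false i).elim
  have hn0 : (0 : K) < n := by
    have : 0 < n := Fin.pos_iff_nonempty.2 hn
    exact_mod_cast this
  -- constants
  set CQ : K := ∑ j, |Q i j| with hCQ
  have hCQ0 : 0 ≤ CQ := Finset.sum_nonneg fun j _ => abs_nonneg _
  have hn1 : (1 : K) ≤ n := by
    have : 1 ≤ n := Nat.one_le_iff_ne_zero.2 (Fin.pos_iff_nonempty.2 hn).ne'
    exact_mod_cast this
  have h2n : (0 : K) < 2 * n * (CQ + 1) := mul_pos (mul_pos two_pos hn0) (by linarith)
  set ε₁ : K := ε / (2 * n * (CQ + 1)) with hε₁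
  have hε₁pos : 0 < ε₁ := div_pos hε h2n
  -- differentiability of the components of `F` at `x₀ = G y₀`, common radius `δ₁`
  have hδl : ∀ l, ∃ δ : K, 0 < δ ∧ ∀ h : Fin n → K, (∀ j, |h j| < δ) →
      |F (G y₀ + h) l - F (G y₀) l - ∑ j, M l j * h j| ≤ ε₁ * ∑ j, |h j| :=
    fun l => hF l ε₁ hε₁pos
  choose δ hδpos hδ using hδl
  set δ₁ : K := Finset.univ.inf' Finset.univ_nonempty δ with hδ₁
  have hδ₁pos : 0 < δ₁ := (Finset.lt_inf'_iff _).2 fun l _ => hδpos l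
  have hδ₁le : ∀ l, δ₁ ≤ δ l := fun l => Finset.inf'_le _ (Finset.mem_univ l)
  -- the radius
  set δ₀ : K := min ρ (δ₁ / (2 * n + 1)) with hδ₀
  have hδ₀pos : 0 < δ₀ := lt_min hρ (div_pos hδ₁pos (by positivity))
  refine ⟨δ₀, hδ₀pos, fun h hh => ?_⟩
  have hhρ : ∀ k, |h k| < ρ := fun k => (hh k).trans_le (min_le_left _ _)
  -- `y = y₀ + h`, `k = G y - G y₀`
  set y : Fin n → K := y₀ + h with hy
  have hyρ : ∀ k, |y k - y₀ k| < ρ := fun k => by simpa [hy] using hhρ k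
  set kv : Fin n → K := G y - G y₀ with hkv
  -- a largest `|h k|`
  obtain ⟨k₀, -, hk₀⟩ :=
    Finset.exists_max_image Finset.univ (fun k => |h k|) Finset.univ_nonempty
  set m : K := |h k₀| with hm
  have hm0 : 0 ≤ m := abs_nonneg _
  have hhm : ∀ k, |h k| ≤ m := fun k => hk₀ k (Finset.mem_univ k)
  set S : K := ∑ j, |h j| with hS
  have hS0 : 0 ≤ S := Finset.sum_nonneg fun j _ => abs_nonneg _
  have hmS : m ≤ S :=
    Finset.single_le_sum (f := fun j => |h j|) (fun j _ => abs_nonneg _) (Finset.mem_univ k₀)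
  -- Lipschitz: `|kv j| ≤ 2 m`
  have hkm : ∀ j, |kv j| ≤ 2 * m := by
    intro j
    have := hLip y hyρ m (fun k => by simpa [hy] using hhm k) j
    simpa [hkv] using this
  -- `|kv j| < δ₁`
  have hmδ : 2 * m < δ₁ := by
    have h1 : m < δ₁ / (2 * n + 1) := (hh k₀).trans_le (min_le_right _ _)
    rw [lt_div_iff₀ (by positivity)] at h1
    have h2 : 2 * m ≤ m * (2 * n + 1) := by nlinarith [hm0, hn1]
    exact lt_of_le_of_lt h2 h1
  have hkδ : ∀ j, |kv j| < δ₁ := fun j => (hkm j).trans_lt hmδ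
  -- differentiability of `F` applied to the increment `kv`
  have hxk : G y₀ + kv = G y := by simp [hkv]
  have herr : ∀ l, |h l - ∑ j, M l j * kv j| ≤ ε₁ * ∑ j, |kv j| := by
    intro l
    have h1 := hδ l kv fun j => (hkδ j).trans_le (hδ₁le l)
    rw [hxk, hFG y hyρ, hFG y₀ (fun k => by simpa using hρ)] at h1
    simpa [hy] using h1
  set e : Fin n → K := fun l => h l - ∑ j, M l j * kv j with he
  -- `kv i = (Q h)_i - (Q e)_i`
  have hQe : ∑ l, Q i l * e l = ∑ l, Q i l * h l - kv i := by
    simp only [he, mul_sub, Finset.sum_sub_distrib]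
    rw [sum_mul_sum_mul_eq_of_mul_eq_one hQM kv i]
  have hmain : G y i - G y₀ i - ∑ l, Q i l * h l = -(∑ l, Q i l * e l) := by
    rw [hQe]
    have : G y i - G y₀ i = kv i := by simp [hkv]
    rw [this]
    ring
  -- bound `|Σ Q i l e l| ≤ CQ ε₁ Σ|kv| ≤ CQ ε₁ n 2 m ≤ 2 n CQ ε₁ S`
  have hsumk : ∑ j, |kv j| ≤ n * (2 * m) := by
    calc ∑ j, |kv j| ≤ ∑ _j : Fin n, 2 * m := Finset.sum_le_sum fun j _ => hkm j
      _ = n * (2 * m) := by simp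
  have hbound : |∑ l, Q i l * e l| ≤ CQ * (ε₁ * (n * (2 * m))) := by
    have h0 := abs_sum_mul_le_sum_abs_mul (Q i) e (M := ε₁ * (n * (2 * m)))
      fun l => (herr l).trans (mul_le_mul_of_nonneg_left hsumk hε₁pos.le)
    simpa only [hCQ] using h0
  show |G y i - G y₀ i - ∑ l, Q i l * h l| ≤ ε * S
  rw [hmain, abs_neg]
  have hc0 : 0 ≤ 2 * n * CQ * ε₁ :=
    mul_nonneg (mul_nonneg (mul_nonneg zero_le_two hn0.le) hCQ0) hε₁pos.le
  calc |∑ l, Q i l * e l| ≤ CQ * (ε₁ * (n * (2 * m))) := hbound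
    _ = (2 * n * CQ * ε₁) * m := by ring
    _ ≤ (2 * n * CQ * ε₁) * S := mul_le_mul_of_nonneg_left hmS hc0
    _ ≤ ε * S := by
        refine mul_le_mul_of_nonneg_right ?_ hS0
        rw [hε₁, mul_div_assoc', div_le_iff₀ h2n]
        nlinarith [mul_nonneg hn0.le hε.le, mul_nonneg (mul_nonneg hn0.le hε.le) hCQ0]

end Literature.ModelTheory.ExponentialFields
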